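import Mathlib
import Summits.Ventures.PercRepro.TriangleCapRowA2CapRef

/-!
# PercRepro — TOWARDS THE CELL `(k, a, a + 2)`: THE COUNTS OF THE CAP (p3, gen 47; part 200zk)

At `r = a + 2` (`K = k − a`, `|R| = a − 1`, `m + a + 2 = aK`): an edge inside `R` is impossible for every
`K ≥ 2a + 2` with the per-vertex degree caps of its ends (`rowA2_noedge`; at `K = 2a + 1` the linear relaxation is
feasible, mining/noedgeA2.py), and `E = 0` gives `(a − 2) M ≤ a + 2`, so `M ≤ 1` for `a ≥ 7` (`rowA2_matching`).
Axioms: standard.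
-/

namespace PercRepro

namespace TriangleCap

namespace C047

/-- **THE COUNT AT `r = a + 2` WITH AN EDGE INSIDE `R`:** impossible for `K ≥ 2a + 2` (`a = a' + 5`). -/
theorem rowA2_noedge (a' K M P E m Pu Pv Pr du dv dr : ℕ) (hK : 2 * (a' + 5) + 2 ≤ K)
    (hdeg : K + (K + 2 * M + P) + (P + E) = 2 * m) (hm : m + (a' + 7) = (a' + 5) * K)
    (h1 : P + E ≤ (a' + 4) * K) (hPuv : Pu + Pv ≤ K + 1) (hrest : Pr + (a' + 2) * M ≤ (a' + 2) * K)
    (hP : P = Pu + Pv + Pr) (hE : E = du + dv + dr) (hu : Pu + du ≤ K) (hv : Pv + dv ≤ K)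
    (hr : Pr + dr ≤ (a' + 2) * K) (hdu : du ≤ a' + 3) (hdv : dv ≤ a' + 3) : False := by
  subst hP hE
  obtain ⟨t, rfl⟩ : ∃ t, K = 2 * (a' + 5) + 2 + t := ⟨K - (2 * (a' + 5) + 2), by omega⟩
  nlinarith [hdeg, hm, h1, hPuv, hrest, hu, hv, hr, hdu, hdv, Nat.zero_le (a' * M), Nat.zero_le (t * M),
    Nat.zero_le (a' * t)]

/-- `(a − 2) M ≤ a + 2` (`a = a' + 5`) ⇒ `M ≤ 2`, and `M = 2` forces `a ≤ 6`. -/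
theorem rowA2_matching (a' K M P m : ℕ) (hdeg : K + (K + 2 * M + P) + (P + 0) = 2 * m)
    (hm : m + (a' + 5 + 2) = (a' + 5) * K) (h2 : P + (a' + 4) * M ≤ (a' + 4) * K) :
    M ≤ 2 ∧ (2 ≤ M → a' ≤ 1) := by
  have key : (a' + 3) * M ≤ a' + 7 := by nlinarith [hdeg, hm, h2]
  constructor
  · by_contra hM
    have hM3 : 3 ≤ M := by omega
    have := Nat.mul_le_mul_left (a' + 3) hM3
    omega
  · intro hM2
    have := Nat.mul_le_mul_left (a' + 3) hM2
    omega

end C047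

end TriangleCap

end PercRepro
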